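import Literature.NumberTheory.Automorphic.Liu2021.AppendixC.AlbaneseTraceOfFiniteQuotientOfCocycle
import Literature.NumberTheory.Automorphic.Liu2021.AppendixC.AlbaneseFiniteQuotientDescent
import Literature.NumberTheory.Automorphic.Liu2021.AlbaneseCocycleDescent
import Literature.NumberTheory.Automorphic.Liu2021.SplittingField
import Literature.AlgebraicGeometry.Motives.AbelianVarietyRigidity
import Literature.AlgebraicGeometry.Motives.VarietiesProperProofs
import Literature.AlgebraicGeometry.Motives.VarietiesGeometricallyIntegralProofs
import HarnessLib

/-!
# The Albanese trace of a finite quotient over ANY field of characteristic zero — discharge of the named fact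
# `AppendixC.AlbaneseTraceOfFiniteQuotient` by RIGIDITY

[Liu2021] = Yifeng Liu, *Fourier–Jacobi cycles and arithmetic relative trace formula*, Camb. J. Math. **9** (2021)
= arXiv:2102.11518 (v2 numbering; `l. NNNN` = lines of `FJcycle.tex`), §2.1 Def. 2.1 (1), Def. 2.3 and the proof of the
Proposition (l. 1194–1200); [Lang1983AbelianVarieties] Ch. VIII §6 Thm. 13; [Milne1986AbelianVarieties] §2 Thm. 2.1
(rigidity) and Cor. 2.5.  PROOF FILE (theorems only; no definition, no named fact, no instance, no `sorry`).  Cell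
hodgecm-mathlib (D-0151), INVENTORY row VI-5: the named fact (T) `AppendixC.AlbaneseTraceOfFiniteQuotient`
(`AppendixC/AlbaneseFiniteQuotientTrace.lean`, STATEMENT ONLY, D-0014) quantifies over ALL fields of characteristic zero in a
universe `u`; the tree proved its statement from the cocycle identity of the Albanese morphism
(`Albanese.exists_trace_of_isCocycle'`, `AppendixC/AlbaneseTraceOfFiniteQuotientOfCocycle.lean`) and the cocycle identity
only for `k : Type` with an embedding into `ℂ` (`Albanese.isCocycle_of_isProjectiveOver`,
`Liu2021/AlbaneseCocycleDescent.lean`, through Milne's complex Albanese data of the pieces).  THIS FILE removes the embedding: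

* `lift_comp_eq_fst_mul_snd_inv_of_diag` — **a diagonal-killing morphism on the square of a pointed, complete, geometrically
  integral variety is a DIFFERENCE MAP**: for `Z` proper and geometrically integral over a field `L` with an `L`-point `z₀`,
  an abelian variety `B` and `β : Z × Z → B` with `β ∘ Δ_Z = 0`, one has `β(a, b) = f(a) − f(b)` with `f = β(−, z₀)`.
  PROOF: Milne AV Cor. 2.5 (tree `Motives.eq_mul_of_point_comp_eq_one`, from the rigidity theorem
  `Motives.AbelianVarietyRigidity.rigidity`) gives `β(a, b) = β(a, z₀) + β(z₀, b)`; on the diagonal `0 = β(a, z₀) + β(z₀, a)`.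
* `lift_comp_mul_lift_comp_of_diag` — hence the COCYCLE IDENTITY `β(p, q) · β(q, r) = β(p, r)` on all `T`-points of
  `Z × Z` (this is what Serre's ∕ Milne's construction supplied in the complex proof: there `β` restricted to a piece was a
  homomorphic image of the difference map `f^P(x) − f^P(y)` of a Jacobian-type datum).
* `Nabla.isCocycle_of_diag_comp_of_isColimit` — for a SPLIT scheme `X' = ⊔_c Y_c` over any field `L` whose pieces are proper,
  geometrically integral and POINTED (`y c : Y_c(L)`), every `∇X'` (Def. 2.1 (1)) and every diagonal-killing `β : ∇X' → B`:
  `β` is a cocycle (`Nabla.IsCocycle`).  The piecewise argument is that of `Albanese.isCocycle_of_isColimit`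
  (`Liu2021/AlbaneseCocycleOfPieces.lean`: the pieces `Y_c × Y_c` cover `∇X'`, the three points restricted to the open
  `p⁻¹(Y_c) ⊆ T` factor through the lift `Y_c × Y_c → ∇X'`, morphisms agreeing on an open cover agree), with Milne's datum
  `𝒥 c` replaced by the `L`-point `y c`.
* `Albanese.isCocycle_of_isProjectiveOver'` — **every Albanese datum (Def. 2.3) of a scheme smooth of some relative
  dimension and projective over ANY field `k` of characteristic zero (any universe) is a cocycle**: split `X` over a finite
  Galois `L ∕ k` into POINTED smooth projective geometrically irreducible pieces
  (`exists_isGalois_isColimit_isSmoothProjective_algPoints`), take a `∇(X_L)` (`Nabla.nonempty_of_isColimit`) and a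
  descended carrier `(∇X)_L ≅ ∇(X_L)` over `X_L × X_L` (`Nabla.exists_of_nabla_baseChange_incl`), apply the previous item to
  `(α_X)_L` and descend (`Nabla.IsCocycle.of_baseChange`) — Liu's «the statement for `X` then follows by Galois descent»
  (l. 1199–1200), with rigidity in place of Serre's construction on the pieces.
* `albaneseTraceOfFiniteQuotient_holds : AlbaneseTraceOfFiniteQuotient.{u}` — **THE NAMED FACT (T) IS A THEOREM**
  (`Albanese.exists_trace_of_isCocycle'` + the previous item): for `k` of characteristic zero, `Δ` finite acting on the
  smooth projective `X`, `p : X ⟶ Y` a quotient for separated test objects with `Y` smooth projective and Albanese data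
  `aX`, `aY`, there is `t : Alb_Y ⟶ Alb_X` with `Alb_p ≫ t = Σ_g Alb_{act g}` (Lang's `h_*`, VIII §6 Thm. 13).
* `Albanese.exists_trace_of_isSepQuotient`, `Albanese.exists_map_comp_eq_zsmul_of_isSepQuotient'` — the consumers
  `exists_trace_of_isSepQuotient_complex` ∕ `exists_map_comp_eq_zsmul_of_isSepQuotient (hT)` WITHOUT the `[Algebra k ℂ]` ∕
  `hT` binders (descent of `Δ`-invariant homomorphisms `Alb_X → B` to `Alb_Y` up to `|Δ|`, INVENTORY row VI-4).

HC_CM is proved only modulo the 7 printed citations until rung 0 closes; nothing in this file discharges a COR-CM binder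
(row VI-5's consumer was closed by the complex route; this file settles the fact AS TYPED).  Ours (formalisation glue);
axioms `propext`, `Classical.choice`, `Quot.sound`.

## References
* [Lang1983AbelianVarieties] S. Lang, *Abelian Varieties* (Springer 1983 reprint of the 1959 edition), Ch. VIII §6 Thm. 13
  and its proof (pp. 224–227: the homomorphism `h_*` with `f_* h_* = m·δ`).
* [Milne1986AbelianVarieties] J. S. Milne, *Abelian Varieties*, Ch. V of Cornell–Silverman (eds.), *Arithmetic Geometry*
  (Springer 1986), §2 Thm. 2.1 (Rigidity Theorem) and Cor. 2.5 (pp. 104–105).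
* [Liu2021] Y. Liu, arXiv:2102.11518 = Camb. J. Math. 9 (2021), §2.1 Def. 2.1 (1)–(2) (l. 1171–1177), Proposition with
  proof (l. 1190–1200), Def. 2.3 (l. 1202–1208).
-/

noncomputable section

open CategoryTheory CategoryTheory.Limits AlgebraicGeometry MonoidalCategory CartesianMonoidalCategory
open Literature.AlgebraicGeometry.Motives

universe u v

namespace Literature.NumberTheory.Automorphic.Liu2021.AppendixC

open AbelianVariety (bcFunctor)
open scoped MonObj

/-! ## §1 Rigidity: diagonal-killing morphisms on the square of a pointed piece are difference maps -/

section Rigidity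

variable {L : Type u} [Field L] {Z : SchemeOver L} [IsProper Z.hom] [GeometricallyIntegral Z.hom]
  {B : AbelianVariety L}

/-- **A diagonal-killing morphism `β : Z × Z → B` is a difference map** (Milne AV Cor. 2.5 applied twice): for `Z` proper and
geometrically integral over `L` with an `L`-point `z₀`, `B` an abelian variety and `β ∘ Δ_Z = 0`, one has
`β = (f ∘ pr₁) · (f ∘ pr₂)⁻¹` with `f = β(−, z₀)` (multiplicative notation of Mathlib's group `Hom_L(Z × Z, B)`).  Indeed
Cor. 2.5 at the point `(z₀, z₀)` (where `β` vanishes, being on the diagonal) gives `β(a, b) = β(a, z₀) · β(z₀, b)`, and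
restricting to the diagonal `1 = β(a, z₀) · β(z₀, a)`.  Ours. [cite: Milne1986AbelianVarieties, §2 Cor. 2.5]
[cite: Liu2021, §2.1 proof of the Proposition (l. 1194–1200)] -/
theorem eq_fst_mul_snd_inv_of_diag (z₀ : 𝟙_ (SchemeOver L) ⟶ Z) (β : Z ⊗ Z ⟶ B.X)
    (hβ : lift (𝟙 Z) (𝟙 Z) ≫ β = 1) :
    β = (fst Z Z ≫ (lift (𝟙 Z) (toUnit Z ≫ z₀) ≫ β)) * (snd Z Z ≫ (lift (𝟙 Z) (toUnit Z ≫ z₀) ≫ β))⁻¹ := by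
  set f := lift (𝟙 Z) (toUnit Z ≫ z₀) ≫ β with hf
  set g := lift (toUnit Z ≫ z₀) (𝟙 Z) ≫ β with hg
  have h0 : lift z₀ z₀ ≫ β = 1 := by
    have : lift z₀ z₀ = z₀ ≫ lift (𝟙 Z) (𝟙 Z) := by rw [comp_lift, Category.comp_id]
    rw [this, Category.assoc, hβ, MonObj.comp_one]
  -- Milne Cor. 2.5: `β(a,b) = β(a,z₀) · β(z₀,b)`
  have hdec := eq_mul_of_point_comp_eq_one β z₀ z₀ h0
  -- on the diagonal: `f · g = 1`
  have hfg : f * g = 1 := by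
    have h1 := congrArg (fun φ => lift (𝟙 Z) (𝟙 Z) ≫ φ) hdec
    simp only [hβ, MonObj.comp_mul, lift_fst_assoc, lift_snd_assoc, Category.id_comp] at h1
    rw [← hf, ← hg] at h1
    exact h1.symm
  have hg' : g = f⁻¹ := eq_inv_of_mul_eq_one_right hfg
  rw [← hf, ← hg, hg', GrpObj.comp_inv] at hdec
  exact hdec

/-- **`T`-points of a difference map**: under the hypotheses of `eq_fst_mul_snd_inv_of_diag`, for all `T`-points `a, b` of `Z`,
`β(a, b) = f(a) · f(b)⁻¹` with `f = β(−, z₀)`. Ours. [cite: Milne1986AbelianVarieties, §2 Cor. 2.5] -/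
theorem lift_comp_eq_mul_inv_of_diag (z₀ : 𝟙_ (SchemeOver L) ⟶ Z) (β : Z ⊗ Z ⟶ B.X)
    (hβ : lift (𝟙 Z) (𝟙 Z) ≫ β = 1) {T : SchemeOver L} (a b : T ⟶ Z) :
    lift a b ≫ β = (a ≫ (lift (𝟙 Z) (toUnit Z ≫ z₀) ≫ β)) * (b ≫ (lift (𝟙 Z) (toUnit Z ≫ z₀) ≫ β))⁻¹ := by
  conv_lhs => rw [eq_fst_mul_snd_inv_of_diag z₀ β hβ]
  rw [MonObj.comp_mul, GrpObj.comp_inv, lift_fst_assoc, lift_snd_assoc]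

/-- **The cocycle identity for a diagonal-killing morphism on the square of a pointed piece**: for `Z` proper and
geometrically integral over `L` with an `L`-point, `B` an abelian variety and `β : Z × Z → B` with `β ∘ Δ_Z = 0`, all
`T`-points `p, q, r` of `Z` satisfy `β(p, q) · β(q, r) = β(p, r)` — immediate from `β(a, b) = f(a) · f(b)⁻¹`
(`lift_comp_eq_mul_inv_of_diag`).  This replaces, over an arbitrary field, the cocycle identity which the complex proof read
off Milne's difference map `f^P(x) − f^P(y)` of the pieces.  Ours. [cite: Milne1986AbelianVarieties, §2 Thm. 2.1 (Rigidity Theorem) and Cor. 2.5]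
[cite: Liu2021, §2.1 proof of the Proposition (l. 1194–1200)] -/
theorem lift_comp_mul_lift_comp_of_diag (z₀ : 𝟙_ (SchemeOver L) ⟶ Z) (β : Z ⊗ Z ⟶ B.X)
    (hβ : lift (𝟙 Z) (𝟙 Z) ≫ β = 1) {T : SchemeOver L} (p q r : T ⟶ Z) :
    (lift p q ≫ β) * (lift q r ≫ β) = lift p r ≫ β := by
  rw [lift_comp_eq_mul_inv_of_diag z₀ β hβ p q, lift_comp_eq_mul_inv_of_diag z₀ β hβ q r,
    lift_comp_eq_mul_inv_of_diag z₀ β hβ p r]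
  group

end Rigidity

/-! ## §2 Split schemes with pointed pieces: every diagonal-killing `∇X' → B` is a cocycle -/

section Split

variable {L : Type u} [Field L] {X' : SchemeOver L} {κ : Type v} [Small.{u} κ] {Y : κ → SchemeOver L}
  {inj : ∀ c, Y c ⟶ X'}

/-- The first coordinate of a `T`-point of `∇X'` over `(p, q)`, evaluated at a point `w` of `T`, is `p(w)`. Ours.
[cite: Liu2021, §2.1 Def. 2.1 (1) (l. 1171–1174)] -/
private theorem fst_incl_apply' (N : Nabla X') {T : SchemeOver L} (p q : T ⟶ X') (pq : T ⟶ N.N)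
    (hpq : pq ≫ N.incl = lift p q) (w : T.left) : (fst X' X').left (N.incl.left (pq.left w)) = p.left w := by
  have : (fst X' X').left (N.incl.left (pq.left w)) = ((pq ≫ N.incl) ≫ fst X' X').left w := by
    simp only [Over.comp_left, Scheme.Hom.comp_apply]
  rw [this, hpq, lift_fst]

/-- The second coordinate of a `T`-point of `∇X'` over `(p, q)`, evaluated at a point `w` of `T`, is `q(w)`. Ours.
[cite: Liu2021, §2.1 Def. 2.1 (1) (l. 1171–1174)] -/
private theorem snd_incl_apply' (N : Nabla X') {T : SchemeOver L} (p q : T ⟶ X') (pq : T ⟶ N.N)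
    (hpq : pq ≫ N.incl = lift p q) (w : T.left) : (snd X' X').left (N.incl.left (pq.left w)) = q.left w := by
  have : (snd X' X').left (N.incl.left (pq.left w)) = ((pq ≫ N.incl) ≫ snd X' X').left w := by
    simp only [Over.comp_left, Scheme.Hom.comp_apply]
  rw [this, hpq, lift_snd]

/-- If `(p, q)` is a `T`-point of `∇X'` and `p(w) ∈ Y_c`, then `q(w) ∈ Y_c` (the pieces `Y_{c'} × Y_{c'}` cover `∇X'`
and are disjoint, `Nabla.snd_mem_range_of_fst_mem_range`). Ours. [cite: Liu2021, §2.1 proof of the Proposition (l. 1194–1200)] -/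
private theorem mem_range_snd_of_mem_range_fst' [Finite κ] (N : Nabla X') (hcol : IsColimit (Cofan.mk X' inj)) (c : κ)
    {T : SchemeOver L} (p q : T ⟶ X') (pq : T ⟶ N.N) (hpq : pq ≫ N.incl = lift p q) (w : T.left)
    (hw : p.left w ∈ Set.range (inj c).left) : q.left w ∈ Set.range (inj c).left := by
  rw [← snd_incl_apply' N p q pq hpq w]
  exact N.snd_mem_range_of_fst_mem_range hcol c (pq.left w) (by rwa [fst_incl_apply' N p q pq hpq w])

omit [Small.{u} κ] in
/-- A morphism `V → X'` (from an open `V ⊆ T`) with image in the piece `Y_c` lifts to `V → Y_c` over `L` (the leg is an open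
immersion). Ours. [cite: Liu2021, §2.1 proof of the Proposition (l. 1194–1200)] -/
private theorem exists_lift_piece' (c : κ) [IsOpenImmersion (inj c).left] {T : SchemeOver L} (V : T.left.Opens)
    (p : T ⟶ X') (hp : ∀ w : T.left, w ∈ V → p.left w ∈ Set.range (inj c).left) :
    ∃ pc : Over.mk (V.ι ≫ T.hom) ⟶ Y c, pc ≫ inj c = Over.homMk V.ι rfl ≫ p := by
  have hsub : Set.range (V.ι ≫ p.left) ⊆ Set.range (inj c).left := by
    rintro _ ⟨z, rfl⟩
    rw [Scheme.Hom.comp_apply]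
    refine hp _ ?_
    have hz : V.ι z ∈ Set.range V.ι := ⟨z, rfl⟩
    rw [Scheme.Opens.range_ι] at hz
    exact hz
  let l₀ := IsOpenImmersion.lift (inj c).left (V.ι ≫ p.left) hsub
  have hl₀ : l₀ ≫ (inj c).left = V.ι ≫ p.left := IsOpenImmersion.lift_fac _ _ _
  refine ⟨Over.homMk l₀ ?_, ?_⟩
  · change l₀ ≫ (Y c).hom = V.ι ≫ T.hom
    rw [← Over.w (inj c), ← Category.assoc, hl₀, Category.assoc, Over.w p]
  · apply Over.OverMorphism.ext
    simp only [Over.comp_left, Over.homMk_left]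
    exact hl₀

omit [Small.{u} κ] in
/-- **The cocycle identity on a pointed piece, in lift form.**  For a `∇X'` (Def. 2.1 (1)), a diagonal-killing
`β : ∇X' → B`, a leg `inj_c : Y_c ⟶ X'` with `Y_c` proper, geometrically integral and pointed, and a lift
`l : Y_c × Y_c → ∇X'` of `inj_c × inj_c`: the morphism `l ≫ β` kills the diagonal of `Y_c`, hence
(`lift_comp_mul_lift_comp_of_diag`) `β(l(p,q)) · β(l(q,r)) = β(l(p,r))` for all `T`-points `p, q, r` of `Y_c`.  Ours.
[cite: Milne1986AbelianVarieties, §2 Cor. 2.5] [cite: Liu2021, §2.1 proof of the Proposition (l. 1194–1200)] -/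
theorem Nabla.lift_comp_lift_comp_mul_of_point (N : Nabla X') {B : AbelianVariety L} (β : N.N ⟶ B.X)
    (hβ : N.diag ≫ β = 1) (c : κ) [IsProper (Y c).hom] [GeometricallyIntegral (Y c).hom]
    (y : 𝟙_ (SchemeOver L) ⟶ Y c) (l : Y c ⊗ Y c ⟶ N.N) (hl : l ≫ N.incl = inj c ⊗ₘ inj c)
    {T : SchemeOver L} (p q r : T ⟶ Y c) :
    (lift p q ≫ l ≫ β) * (lift q r ≫ l ≫ β) = lift p r ≫ l ≫ β := by
  have hdiag : lift (𝟙 (Y c)) (𝟙 (Y c)) ≫ l = inj c ≫ N.diag := by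
    rw [← cancel_mono N.incl, Category.assoc, hl, lift_map, Category.assoc, N.diag_incl, comp_lift,
      Category.id_comp, Category.comp_id]
  have h1 : lift (𝟙 (Y c)) (𝟙 (Y c)) ≫ (l ≫ β) = 1 := by
    rw [← Category.assoc, hdiag, Category.assoc, hβ, MonObj.comp_one]
  exact lift_comp_mul_lift_comp_of_diag y (l ≫ β) h1 p q r

/-- **Every diagonal-killing morphism from `∇` of a split scheme with pointed pieces is a cocycle.**  For ANY field `L`,
a colimit cofan `inj_c : Y_c ⟶ X'` (`κ` finite) whose pieces `Y_c` are proper, geometrically integral and POINTED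
(`y c : Y_c(L)`), ANY `∇X'` (Def. 2.1 (1)), an abelian variety `B` and `β : ∇X' → B` with `ΔX' ≫ β = 1`: `β` satisfies
the cocycle identity `β(a,b) · β(b,c) = β(a,c)` on all `T`-points of `∇X'` (`Nabla.IsCocycle`).  PROOF: as for
`Albanese.isCocycle_of_isColimit` — restrict to the open cover `T = ⋃_c a⁻¹(Y_c)`, where the three points factor through
the lift `Y_c × Y_c → ∇X'`, and use `Nabla.lift_comp_lift_comp_mul_of_point` (rigidity) on the piece; morphisms to `B`
agreeing on an open cover agree (Mathlib `Scheme.Cover.hom_ext`).  Ours. [cite: Liu2021, §2.1 Def. 2.1 (1) (l. 1171–1174) and proof of the Proposition (l. 1194–1200)]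
[cite: Milne1986AbelianVarieties, §2 Thm. 2.1 (Rigidity Theorem) and Cor. 2.5] -/
theorem Nabla.isCocycle_of_diag_comp_of_isColimit [Finite κ] (N : Nabla X') (hcol : IsColimit (Cofan.mk X' inj))
    [∀ c, IsProper (Y c).hom] [∀ c, GeometricallyIntegral (Y c).hom] (y : ∀ c, 𝟙_ (SchemeOver L) ⟶ Y c)
    {B : AbelianVariety L} (β : N.N ⟶ B.X) (hβ : N.diag ≫ β = 1) : N.IsCocycle β := by
  classical
  haveI := fun c => isOpenImmersion_left_of_isColimit hcol c
  intro T p q r pq qr pr hpq hqr hpr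
  -- lifts of the pieces `Y_c × Y_c → ∇X'`
  choose l hl using fun c => exists_lift_tensorHom (inj := inj) N c
  -- the open cover `T = ⋃_c p⁻¹(Y_c)`
  set R : κ → Set X'.left := fun c => Set.range (inj c).left with hR
  have hRo : ∀ c, IsOpen (R c) := fun c => (isClopen_range_left_of_isColimit hcol c).2
  let V : κ → T.left.Opens := fun c => ⟨p.left ⁻¹' R c, (hRo c).preimage p.left.continuous⟩
  have hV : TopologicalSpace.IsOpenCover V := by
    refine TopologicalSpace.IsOpenCover.mk (eq_top_iff.2 fun w _ => ?_)
    obtain ⟨c, y, hy⟩ := exists_eq_left_of_isColimit hcol (p.left w)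
    exact TopologicalSpace.Opens.mem_iSup.2 ⟨c, show p.left w ∈ R c from ⟨y, hy⟩⟩
  -- it suffices to check the identity on each `p⁻¹(Y_c)`
  apply Over.OverMorphism.ext
  refine Scheme.Cover.hom_ext (T.left.openCoverOfIsOpenCover V hV) _ _ fun c => ?_
  rw [Scheme.openCoverOfIsOpenCover_f]
  change (V c).ι ≫ _ = (V c).ι ≫ _
  -- the three points restricted to `p⁻¹(Y_c)` factor through `Y_c × Y_c`
  set Tc : SchemeOver L := Over.mk ((V c).ι ≫ T.hom)
  set ιc : Tc ⟶ T := Over.homMk (V c).ι rfl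
  have hpV : ∀ w : T.left, w ∈ V c → p.left w ∈ Set.range (inj c).left := fun w hw => hw
  have hqV : ∀ w : T.left, w ∈ V c → q.left w ∈ Set.range (inj c).left := fun w hw =>
    mem_range_snd_of_mem_range_fst' N hcol c p q pq hpq w (hpV w hw)
  have hrV : ∀ w : T.left, w ∈ V c → r.left w ∈ Set.range (inj c).left := fun w hw =>
    mem_range_snd_of_mem_range_fst' N hcol c q r qr hqr w (hqV w hw)
  obtain ⟨pc, hpc⟩ := exists_lift_piece' c (V c) p hpV
  obtain ⟨qc, hqc⟩ := exists_lift_piece' c (V c) q hqV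
  obtain ⟨rc, hrc⟩ := exists_lift_piece' c (V c) r hrV
  have key : ∀ (u v : T ⟶ X') (uv : T ⟶ N.N) (huv : uv ≫ N.incl = lift u v) (uc vc : Tc ⟶ Y c),
      uc ≫ inj c = ιc ≫ u → vc ≫ inj c = ιc ≫ v → ιc ≫ uv = lift uc vc ≫ l c := by
    intro u v uv huv uc vc huc hvc
    rw [← cancel_mono N.incl, Category.assoc, huv, comp_lift, Category.assoc, hl, lift_map, huc, hvc]
  have H : ιc ≫ ((pq ≫ β) * (qr ≫ β)) = ιc ≫ (pr ≫ β) := by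
    rw [MonObj.comp_mul, ← Category.assoc, ← Category.assoc, ← Category.assoc,
      key p q pq hpq pc qc hpc hqc, key q r qr hqr qc rc hqc hrc, key p r pr hpr pc rc hpc hrc,
      Category.assoc, Category.assoc, Category.assoc]
    exact N.lift_comp_lift_comp_mul_of_point β hβ c (y c) (l c) (hl c) pc qc rc
  have H' := congrArg CommaMorphism.left H
  simp only [Over.comp_left, Over.homMk_left, ιc] at H'
  exact H'

end Split

/-! ## §3 Any field of characteristic zero: every Albanese datum is a cocycle -/

set_option backward.isDefEq.respectTransparency false in
/-- **[Liu2021, §2.1] Every Albanese datum of a smooth projective scheme over ANY field of characteristic zero is a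
cocycle** (universe-polymorphic; supersedes the `[Algebra k ℂ]` binder of `Albanese.isCocycle_of_isProjectiveOver`).  For
`k` of characteristic zero, `X` smooth of relative dimension `d` and projective over `k`, and ANY `aX : AppendixC.Albanese X`
(Def. 2.3, corepresentability typing), the Albanese morphism satisfies `α(a,b) · α(b,c) = α(a,c)` on all `T`-points of `∇X`
(`Albanese.IsCocycle`).  PROOF: split `X` over a finite Galois `L ∕ k` into POINTED smooth projective geometrically
irreducible pieces (`exists_isGalois_isColimit_isSmoothProjective_algPoints`); a `∇(X_L)` (`Nabla.nonempty_of_isColimit`) and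
a descended carrier `(∇X)_L ≅ ∇(X_L)` over `X_L × X_L` (`Nabla.exists_of_nabla_baseChange_incl`); the base change of the
diagonal-killing `α_X` (read on the descended carrier) is diagonal-killing, hence a cocycle over `L` by RIGIDITY
(`Nabla.isCocycle_of_diag_comp_of_isColimit`); descend (`Nabla.IsCocycle.of_baseChange`) and transport to `aX.nabla`
(`Nabla.IsCocycle.comp_map`).  Ours — Liu's «by Galois descent» (l. 1199–1200) with Milne AV Cor. 2.5 on the pieces.
[cite: Liu2021, §2.1 Proposition with proof (l. 1190–1200), Def. 2.3 (l. 1202–1208)]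
[cite: Milne1986AbelianVarieties, §2 Thm. 2.1 (Rigidity Theorem) and Cor. 2.5] -/
theorem Albanese.isCocycle_of_isProjectiveOver' {k : Type u} [Field k] [CharZero k] {d : ℕ}
    {X : SchemeOver k} [SmoothOfRelativeDimension d X.hom] (hX : IsProjectiveOver X) (aX : Albanese X) :
    aX.IsCocycle := by
  obtain ⟨L, _, _, _, _, C, _, E, inj, hE, hpt, ⟨hcol⟩⟩ :=
    exists_isGalois_isColimit_isSmoothProjective_algPoints (d := d) X hX
  have hirr : ∀ c, GeometricallyIrreducible (E c).hom := fun c => (hE c).geometricallyIrreducible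
  haveI : ∀ c, IsProper (E c).hom := fun c => IsSmoothProjective.isProper_holds (hE c)
  haveI : ∀ c, GeometricallyIntegral (E c).hom := fun c => IsSmoothProjective.geometricallyIntegral_holds (hE c)
  -- the `L`-points of the pieces, as morphisms from the unit
  have y : ∀ c, 𝟙_ (SchemeOver L) ⟶ E c := fun c => toSpecOver _ ≫ (hpt c).some
  -- a `∇(X_L)` and a descended carrier `N₀` with `(N₀)_L ≅ ∇(X_L)` over `X_L × X_L`
  obtain ⟨N'⟩ := Nabla.nonempty_of_isColimit hcol hirr
  obtain ⟨N₀, e, he, hediag⟩ := Nabla.exists_of_nabla_baseChange_incl L N'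
  -- reduce to the carrier `N₀`
  set β₀ : N₀.N ⟶ aX.Alb.X := N₀.map aX.nabla (𝟙 X) ≫ aX.α with hβ₀
  suffices h0 : N₀.IsCocycle β₀ by
    have hα : aX.α = aX.nabla.map N₀ (𝟙 X) ≫ β₀ := by
      rw [hβ₀, ← Category.assoc, ← Nabla.map_comp, Category.comp_id, Nabla.map_id, Category.id_comp]
    change aX.nabla.IsCocycle aX.α
    rw [hα]
    exact h0.comp_map aX.nabla (𝟙 X)
  have hβ₀1 : N₀.diag ≫ β₀ = 1 := by
    rw [hβ₀, ← Category.assoc, Nabla.diag_map, Category.id_comp, aX.diag_α]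
  refine Nabla.IsCocycle.of_baseChange L N₀ β₀ N' e he
    (N'.isCocycle_of_diag_comp_of_isColimit hcol y (B := aX.Alb.baseChange L) _ ?_)
  rw [← hediag, Category.assoc, Iso.hom_inv_id_assoc, ← Functor.map_comp, hβ₀1]
  exact Functor.map_one _

/-! ## §4 The named fact (T) and its consumers, unconditionally -/

/-- **THE ALBANESE TRACE OF A FINITE QUOTIENT — the named fact `AppendixC.AlbaneseTraceOfFiniteQuotient` is a THEOREM**
(Lang, *Abelian Varieties*, VIII §6 Thm. 13 in Liu's base-point-free language): for every field `k` of characteristic zero,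
smooth projective `X`, `Y` over `k`, a finite group `Δ` acting on `X` with a quotient `p : X ⟶ Y` for separated test
objects, and Albanese data `aX`, `aY` (Def. 2.3), there is `t : Alb_Y ⟶ Alb_X` with `Alb_p ≫ t = Σ_{g ∈ Δ} Alb_{act g}`.
Assembly: `Albanese.exists_trace_of_isCocycle'` (flat descent of the `(Δ × Δ)`-invariant extension of
`α_X ≫ Σ_g Alb_g` along `p × p`, given the cocycle) + `Albanese.isCocycle_of_isProjectiveOver'` (the cocycle, by rigidity).
[cite: Lang1983AbelianVarieties, Ch. VIII §6 Thm. 13, proof, pp. 224–227 (the homomorphism h_*)]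
[cite: Liu2021, §2.1 Proposition with proof (l. 1190–1200), Def. 2.3 (l. 1202–1208)] -/
theorem albaneseTraceOfFiniteQuotient_holds : AlbaneseTraceOfFiniteQuotient.{u} := by
  intro k _ _ X Y dX dY _ _ hX hY Δ _ _ act p hp aX aY
  exact Albanese.exists_trace_of_isCocycle' (dX := dX) (dY := dY) hX hY act p hp aX aY
    (Albanese.isCocycle_of_isProjectiveOver' (d := dX) hX aX)

namespace Albanese

/-- **The Albanese trace of a finite quotient, over any field of characteristic zero** (the statement of
`exists_trace_of_isSepQuotient_complex` without the embedding into `ℂ`, universe-polymorphic in `k` and `Δ`): for `Δ`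
finite acting on the smooth projective `X`, `p : X ⟶ Y` a quotient for separated test objects with `Y` smooth projective
and Albanese data `aX`, `aY`, there is `t : Alb_Y ⟶ Alb_X` with `Alb_p ≫ t = Σ_g Alb_{act g}`.
[cite: Lang1983AbelianVarieties, Ch. VIII §6, Thm. 13 (pp. 224–227)] -/
theorem exists_trace_of_isSepQuotient {k : Type u} [Field k] [CharZero k] {X Y : SchemeOver k} {dX dY : ℕ}
    [SmoothOfRelativeDimension dX X.hom] [SmoothOfRelativeDimension dY Y.hom]
    (hX : IsProjectiveOver X) (hY : IsProjectiveOver Y) {Δ : Type v} [Group Δ] [Fintype Δ]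
    (act : Δ →* Aut X) (p : X ⟶ Y) (hp : IsSepQuotient (fun g => act g) p) (aX : Albanese X) (aY : Albanese Y) :
    ∃ t : aY.Alb ⟶ aX.Alb, aX.map aY p ≫ t = ∑ g, aX.map aX (act g).hom :=
  exists_trace_of_isCocycle' (dX := dX) (dY := dY) hX hY act p hp aX aY (isCocycle_of_isProjectiveOver' (d := dX) hX aX)

/-- **Descent up to isogeny along a finite quotient, unconditionally** (INVENTORY row VI-4, generic half;
`exists_map_comp_eq_zsmul_of_isSepQuotient` with its `hT : AlbaneseTraceOfFiniteQuotient` binder discharged): for `Δ`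
finite acting on the smooth projective `X` over a field of characteristic zero with smooth projective quotient
`p : X ⟶ Y` (for separated test objects), every homomorphism `φ : Alb_X ⟶ B` with `Alb_{g} ≫ φ = φ` for all `g ∈ Δ`
satisfies `Alb_p ≫ ψ = m • φ` for some `ψ : Alb_Y ⟶ B` and an integer `m ≠ 0` (`m = |Δ|`, `ψ = t ≫ φ`).
[cite: Lang1983AbelianVarieties, Ch. VIII §6 Thm. 13, pp. 224–227] -/
theorem exists_map_comp_eq_zsmul_of_isSepQuotient' {k : Type u} [Field k] [CharZero k] {X Y : SchemeOver k}
    {dX dY : ℕ} [SmoothOfRelativeDimension dX X.hom] [SmoothOfRelativeDimension dY Y.hom]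
    (hX : IsProjectiveOver X) (hY : IsProjectiveOver Y)
    {Δ : Type u} [Group Δ] [Fintype Δ] (act : Δ →* Aut X) (p : X ⟶ Y) (hp : IsSepQuotient (fun g => act g) p)
    (aX : Albanese X) (aY : Albanese Y) {B : AbelianVariety k} (φ : aX.Alb ⟶ B)
    (hφ : ∀ g : Δ, aX.map aX (act g).hom ≫ φ = φ) :
    ∃ (m : ℤ) (ψ : aY.Alb ⟶ B), m ≠ 0 ∧ aX.map aY p ≫ ψ = m • φ :=
  exists_map_comp_eq_zsmul_of_isSepQuotient albaneseTraceOfFiniteQuotient_holds (dX := dX) (dY := dY) hX hY act p hp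
    aX aY φ hφ

end Albanese

end Literature.NumberTheory.Automorphic.Liu2021.AppendixC

end
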